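import Mathlib
import Literature.NumberTheory.LFunctions.Zhang2022.Section7aStatements
import HarnessLib

/-!
# Zhang (2022) §7/§14: the size of `Z(s,θ)⁻¹` to the right of the critical line, for any primitive `θ`

Topic `Literature/NumberTheory/LFunctions/Zhang2022` (Landau–Siegel adjudication tree; verdict-neutral;
cell siegel-zhang, toward `Z22:(14.3)` = `Typed.Sec14.DedEq143`). Y. Zhang, *Discrete mean estimates
and the Landau–Siegel zero*, arXiv:2211.02515v1 (2022) [Zhang2022LandauSiegel] — **an unrefereed
manuscript under adjudication; nothing here bears on its Theorems 1–2 or on Landau–Siegel zeros.**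
§7 p. 34 (tex L1882): "`Z(s,ψ)⁻¹ ≪ (pt₀)^{σ−1/2}` for `3/2 ≤ σ ≤ 𝓛⁹`, `|t − 2πt₀| ≤ 𝓛₁`"; §14 p. 76
uses the same step for `Z(s,ψχ)` (modulus `Dp`): "Similar to the proof of Proposition 7.1 …" (14.3).

`Typed.Sec14.Eq143.norm_Zfac_inv_le_of_isPrimitive` — the tree's `Section7aStatements.norm_Zfac_inv_le`
(L2-t2, stated for the family member `ψ (mod p)`) VERBATIM for an arbitrary primitive character `θ`
to a modulus `k ≥ 2`: for `D ≥ 3`, `1/2 ≤ σ ≤ 𝓛⁹ + 1/2`, `|t − 2πt₀| ≤ 𝓛₁`: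
`|Z(s,θ)⁻¹| ≤ e³ (kt₀)^{σ−1/2}` (`|Z(½+it,θ)| = 1`, `Lemma45.eq_mul_exp_integral_logDeriv_segment`,
Stirling `GammaFactor.norm_logDeriv_Zfac_add_log_le`). Needed for `θ = ψχ (mod Dp)` in (14.3).
Theorems only; no new definition, no named fact.

## References

* Y. Zhang, arXiv:2211.02515v1 (2022), §7 p. 34 (tex L1882); §14 (14.3) p. 76.
  [cite: Zhang2022LandauSiegel, §7 p. 34; §14 (14.3) p. 76]
-/

noncomputable section

open Complex Real Set MeasureTheory intervalIntegral

namespace Literature.NumberTheory.LFunctions.Zhang2022.Typed.Sec14.Eq143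

/-- `𝓛 = log D ≥ 1` for `D ≥ 3`. [folklore] -/
private theorem one_le_ell' {D : ℕ} (hD : 3 ≤ D) : 1 ≤ Skeleton.ell D := by
  have hD' : (3 : ℝ) ≤ D := by exact_mod_cast hD
  have h : (1 : ℝ) < Real.log 3 := by
    rw [Real.lt_log_iff_exp_lt (by norm_num)]
    exact Real.exp_one_lt_d9.trans (by norm_num)
  exact le_trans h.le (Real.log_le_log (by norm_num) hD')

/-- **`|Z(s,θ)⁻¹| ≤ e³ (kt₀)^{σ−1/2}`** for ANY primitive `θ (mod k)`, `k ≥ 2`, on `1/2 ≤ σ ≤ 𝓛⁹ + 1/2`,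
`|t − 2πt₀| ≤ 𝓛₁` (`D ≥ 3`) — the estimate `Z22:§7.u016` / its (14.3) twin for `θ = ψχ (mod Dp)`;
proof copied from `Section7aStatements.norm_Zfac_inv_le` with the modulus made a parameter.
[cite: Zhang2022LandauSiegel, §7 p. 34, tex L1882; §14 (14.3) p. 76] -/
theorem norm_Zfac_inv_le_of_isPrimitive {D : ℕ} (hD : 3 ≤ D) {k : ℕ} [NeZero k]
    {θ : DirichletCharacter ℂ k} (hθ : θ.IsPrimitive) (hk : 2 ≤ k) {s : ℂ}
    (hσ1 : 1 / 2 ≤ s.re) (hσ2 : s.re ≤ Skeleton.ell D ^ 9 + 1 / 2)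
    (ht : |s.im - 2 * π * Skeleton.t0 D| ≤ Skeleton.ell1 D) :
    ‖(GammaFactor.Zfac θ s)⁻¹‖ ≤ Real.exp 3 * ((k : ℝ) * Skeleton.t0 D) ^ (s.re - 1 / 2) := by
  have hℓ : 1 ≤ Skeleton.ell D := one_le_ell' hD
  set ℓ := Skeleton.ell D with hℓdef
  set A : ℝ := ℓ ^ 9 + 1 / 2 with hAdef
  have hℓ9 : 1 ≤ ℓ ^ 9 := one_le_pow₀ hℓ
  have hA1 : 1 ≤ A := by rw [hAdef]; linarith
  set T : ℝ := 2 * π * Skeleton.t0 D with hTdef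
  have ht0def : Skeleton.t0 D = ℓ ^ 519 := rfl
  have hℓ519 : 1 ≤ ℓ ^ 519 := one_le_pow₀ hℓ
  have hπ3 : 3 < π := Real.pi_gt_three
  have hT0 : 0 < T := by rw [hTdef, ht0def]; positivity
  -- comparison of powers of `ℓ ≥ 1`
  have hpow1 : ℓ ^ 9 ≤ ℓ ^ 519 := pow_le_pow_right₀ hℓ (by norm_num)
  have hpow2 : ℓ ^ 405 ≤ ℓ ^ 519 := pow_le_pow_right₀ hℓ (by norm_num)
  have hpow3 : ℓ ^ 414 ≤ ℓ ^ 519 := pow_le_pow_right₀ hℓ (by norm_num)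
  have h4A : 4 * A ≤ T := by
    rw [hAdef, hTdef, ht0def]
    nlinarith [mul_nonneg (sub_nonneg.mpr hπ3.le) (zero_le_one.trans hℓ519)]
  set y : ℝ := s.im - T with hydef
  have hy : |y| ≤ Skeleton.ell1 D := by rw [hydef, hTdef]; exact ht
  have hell1 : Skeleton.ell1 D = ℓ ^ 405 := rfl
  have hyT : |y| ≤ T / 2 := by
    rw [hell1] at hy; rw [hTdef, ht0def]; nlinarith
  -- the segment from `a = ½ + i·Im s` to `s`, `w = σ − ½`
  set σ := s.re with hσdef
  have hw0 : 0 ≤ σ - 1 / 2 := by linarith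
  have hw9 : σ - 1 / 2 ≤ ℓ ^ 9 := by rw [hℓdef]; linarith
  set w : ℂ := ((σ - 1 / 2 : ℝ) : ℂ) with hw
  set a : ℂ := (1 / 2 : ℂ) + s.im * I with ha
  have him_s : 0 < s.im := by
    have h1 : -|y| ≤ y := neg_abs_le y
    have h2 : y = s.im - T := hydef
    linarith
  have hpt : ∀ r : ℝ, a + (r : ℂ) * w = ((1 / 2 + r * (σ - 1 / 2) : ℝ) : ℂ) + s.im * I := by
    intro r; rw [ha, hw]; push_cast; ring
  have him : ∀ r : ℝ, 0 < (a + (r : ℂ) * w).im := by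
    intro r; rw [hpt]; simpa using him_s
  have hg : ∀ r ∈ Icc (0 : ℝ) 1, AnalyticAt ℂ (GammaFactor.Zfac θ) (a + r * w) :=
    fun r _ => GammaFactor.analyticAt_Zfac θ (him r)
  have h0 : ∀ r ∈ Icc (0 : ℝ) 1, GammaFactor.Zfac θ (a + r * w) ≠ 0 :=
    fun r _ => GammaFactor.Zfac_ne_zero hθ (him r)
  have key := Lemma45.eq_mul_exp_integral_logDeriv_segment hg h0
  have haw : a + w = s := by
    rw [ha, hw]; apply Complex.ext <;> simp [hσdef]
  have ha1 : ‖GammaFactor.Zfac θ a‖ = 1 := by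
    rw [ha]; exact GammaFactor.norm_Zfac_half_eq_one hθ him_s
  -- the Stirling bound along the segment, base height `T = 2πt₀`
  set L : ℝ := Real.log ((k : ℝ) * Skeleton.t0 D) with hL
  set δ : ℝ := (2 * |y| + 4 * A + 10) / T with hδ
  have hLT : Real.log ((k : ℝ) * T / (2 * π)) = L := by
    rw [hL, hTdef]; congr 1; field_simp
  have hp2 : (2 : ℝ) ≤ k := by exact_mod_cast hk
  have hL0 : 0 ≤ L := by
    rw [hL]; apply Real.log_nonneg; rw [ht0def]; nlinarith
  have hpw : ∀ r ∈ Set.uIoc (0 : ℝ) 1,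
      ‖deriv (GammaFactor.Zfac θ) (a + r * w) / GammaFactor.Zfac θ (a + r * w)‖ ≤ L + δ := by
    intro r hr
    have hr' : 0 ≤ r ∧ r ≤ 1 := by
      rw [Set.uIoc_of_le zero_le_one] at hr; exact ⟨hr.1.le, hr.2⟩
    have hrw : 0 ≤ r * (σ - 1 / 2) := mul_nonneg hr'.1 hw0
    have hrw' : r * (σ - 1 / 2) ≤ 1 * ℓ ^ 9 := mul_le_mul hr'.2 hw9 hw0 zero_le_one
    have hu0 : 0 < 1 / 2 + r * (σ - 1 / 2) := by linarith
    have hu1 : 1 / 2 + r * (σ - 1 / 2) ≤ A := by rw [hAdef]; linarith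
    have hlog := GammaFactor.norm_logDeriv_Zfac_add_log_le hθ (A := A)
      (σ := 1 / 2 + r * (σ - 1 / 2)) (t := T) (y := y) hA1 hu0 hu1 h4A hyT
    have hpt' : ((1 / 2 + r * (σ - 1 / 2) : ℝ) : ℂ) + T * I + (y : ℂ) * I = a + r * w := by
      rw [hpt, hydef]; push_cast; ring
    rw [hpt', logDeriv_apply, hLT] at hlog
    calc ‖deriv (GammaFactor.Zfac θ) (a + r * w) / GammaFactor.Zfac θ (a + r * w)‖
        = ‖(deriv (GammaFactor.Zfac θ) (a + r * w) / GammaFactor.Zfac θ (a + r * w) + (L : ℂ))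
            - (L : ℂ)‖ := by rw [add_sub_cancel_right]
      _ ≤ ‖deriv (GammaFactor.Zfac θ) (a + r * w) / GammaFactor.Zfac θ (a + r * w) + (L : ℂ)‖
            + ‖(L : ℂ)‖ := norm_sub_le _ _
      _ ≤ δ + L := by
          rw [Complex.norm_real, Real.norm_of_nonneg hL0]; exact add_le_add hlog le_rfl
      _ = L + δ := add_comm _ _
  have hint := intervalIntegral.norm_integral_le_of_norm_le_const hpw
  rw [sub_zero, abs_one, mul_one] at hint
  -- the error exponent `(σ − ½)δ ≤ 3`
  have hδ3 : (σ - 1 / 2) * δ ≤ 3 := by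
    have hnum : 2 * |y| + 4 * A + 10 ≤ 18 * ℓ ^ 405 := by
      rw [hell1] at hy; rw [hAdef]
      have : ℓ ^ 9 ≤ ℓ ^ 405 := pow_le_pow_right₀ hℓ (by norm_num)
      have h405 : 1 ≤ ℓ ^ 405 := one_le_pow₀ hℓ
      linarith
    have hδ' : δ ≤ 18 * ℓ ^ 405 / T := by
      rw [hδ]; exact div_le_div_of_nonneg_right hnum hT0.le
    calc (σ - 1 / 2) * δ ≤ ℓ ^ 9 * (18 * ℓ ^ 405 / T) :=
          mul_le_mul hw9 hδ' (by rw [hδ]; positivity) (by positivity)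
      _ = 18 * ℓ ^ 414 / (2 * π * ℓ ^ 519) := by rw [hTdef, ht0def]; ring
      _ ≤ 18 * ℓ ^ 519 / (6 * ℓ ^ 519) := by
          gcongr
          · linarith
      _ = 18 / 6 := by field_simp
      _ ≤ 3 := by norm_num
  -- assemble
  have hZinv : (GammaFactor.Zfac θ s)⁻¹ =
      (GammaFactor.Zfac θ a)⁻¹ * Complex.exp (-(w * ∫ r in (0 : ℝ)..1,
        deriv (GammaFactor.Zfac θ) (a + r * w) / GammaFactor.Zfac θ (a + r * w))) := by
    rw [← haw, key, mul_inv, Complex.exp_neg]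
  rw [hZinv, norm_mul, norm_inv, ha1, inv_one, one_mul, Complex.norm_exp]
  have hre : (-(w * ∫ r in (0 : ℝ)..1, deriv (GammaFactor.Zfac θ) (a + r * w) /
        GammaFactor.Zfac θ (a + r * w))).re ≤ (σ - 1 / 2) * (L + δ) := by
    calc (-(w * ∫ r in (0 : ℝ)..1, deriv (GammaFactor.Zfac θ) (a + r * w) /
            GammaFactor.Zfac θ (a + r * w))).re
        ≤ ‖-(w * ∫ r in (0 : ℝ)..1, deriv (GammaFactor.Zfac θ) (a + r * w) /
            GammaFactor.Zfac θ (a + r * w))‖ := Complex.re_le_norm _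
      _ = (σ - 1 / 2) * ‖∫ r in (0 : ℝ)..1, deriv (GammaFactor.Zfac θ) (a + r * w) /
            GammaFactor.Zfac θ (a + r * w)‖ := by
          rw [norm_neg, norm_mul, hw, Complex.norm_real, Real.norm_of_nonneg hw0]
      _ ≤ (σ - 1 / 2) * (L + δ) := by gcongr
  have hpt0 : 0 < (k : ℝ) * Skeleton.t0 D := by rw [ht0def]; positivity
  calc Real.exp (-(w * ∫ r in (0 : ℝ)..1, deriv (GammaFactor.Zfac θ) (a + r * w) /
          GammaFactor.Zfac θ (a + r * w))).re
      ≤ Real.exp ((σ - 1 / 2) * (L + δ)) := Real.exp_le_exp.mpr hre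
    _ = Real.exp ((σ - 1 / 2) * δ) * ((k : ℝ) * Skeleton.t0 D) ^ (σ - 1 / 2) := by
        rw [Real.rpow_def_of_pos hpt0, ← hL, ← Real.exp_add]; congr 1; ring
    _ ≤ Real.exp 3 * ((k : ℝ) * Skeleton.t0 D) ^ (σ - 1 / 2) := by
        gcongr

end Literature.NumberTheory.LFunctions.Zhang2022.Typed.Sec14.Eq143

end
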